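import Summits.QuantumFields.BalabanUV.Beta.FP.TowerK2bDoorPairingSummable
import Summits.QuantumFields.BalabanUV.Beta.FP.ConvolutionAbsMoment

/-!
# `BalabanUV.Beta.FP.TowerK2bDoorReadoutSummable` — binder row D1 ∕ (C1) OWNER «beta-an2», PART 44: **THE SUMMABLE CUT OF PART 42** — summation by parts against the lattice
# divergence on `ℤᵈ` for a 1-form with absolutely summable second moments; a CO-CLOSED such form has no column sum and no longitudinal dipole, antisymmetric transverse dipoles;
# a REFLECTION-EVEN one has no dipole at all — PART 42 §1–§3 with `∑'` in place of windows (record-inhabitable letters for the read-out column `Ŝ = wPhi`)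

WHY.  PART 43 (`TowerK2bDoorPairingSummable`) re-cut PART 41 without finite-support letters; this file does the same for PART 42, so that the road's END socket
(`FP/StepRecursionFeedNestedCompDoorPairing` §4-to-be) can display (U) `hΘ`, (C) `hdiv`, (R) and the `AbsMoment₂` letters ONLY, and discharge an4's `hM0₁ hM1₁ hM2₁ hM2F₁` on `ℤ⁴`
by PART 43 §2–§3 fed with THIS file's `hS0`∕dipole conclusions (J-NOTE-19 §2).
§1 **`tsum_mul_latticeDiv_eq`** — `∑' y, f y·Σ_κ (A κ y − A κ (y − e κ)) = Σ_κ ∑' w, (f w − f (w + e κ))·A κ w` for `AbsMoment₂ (A κ)` and `|f y| ≤ B(1 + |y|₁²)` (shift by `Equiv.tsum_eq`;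
   the shifted weight's growth by `FP/ConvolutionAbsMoment.one_add_l1_add_sq_le` BY NAME); **`sum_tsum_shiftDiff_mul_eq_zero_of_coclosed`** — co-closed ⇒ the right side vanishes;
§2 `f = c` additive (`|c z| ≤ K|z|₁`): **`sum_weight_tsum_eq_zero_of_coclosed`**, **`tsum_col_eq_zero_of_coclosed`** (`∑' w, A μ w = 0` — PART 43's `hS0`); `f = c·c′`:
   **`sum_weight_tsumFirstMoments_eq_zero_of_coclosed`**, **`tsum_longitudinalDipole_eq_zero_of_coclosed`**, **`tsum_transverseDipoles_antisymm_of_coclosed`**;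
§3 **`tsum_firstMoment_eq_zero_of_reflect`** (`Equiv.tsum_eq R`), **`tsum_dipoles_eq_zero_of_coclosed_of_reflect`** — THE PACKAGE: no dipole at all (PART 43's `hS1`).
[folklore] `tsum` algebra BY NAME; no `def`, nothing cited, 0 sorry; imports PART 43 + `FP/ConvolutionAbsMoment` (one `ℓ¹` lemma by name).  Nothing of Bałaban's asserted, valued or discharged; co-closedness ∕ reflection parities ∕ summability
are DISPLAYED letters, NOT claimed of the record; `hD1∕hD2∕hDF` NOT discharged at the record's letters; 0∕4 row-D1 binders (hW ∕ hR ∕ D1Tel ∕ D1Rep); NOT (C1), NOT (T-ID), NOT D1,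
NEVER «G-an2-4 closed», NOT BetaPertH, NOT continuum, NOT Clay.
HONEST DEPENDENCY (page 1, mandatory): continuum YM on T⁴ ⇐ BetaPertH ∧ nine spine estimates (0/9 proved); BetaPertH ⇐ (D1) ∧ (D4) ∧ CAP+tail;
G-an2-4 gates asym, D1 and NE2/3/4.  HONEST FRAMING (cell contract, verbatim): «discharging `BetaPertH` makes Bałaban's UV stability UNCONDITIONAL —
a real constructive-QFT result; it is NOT the continuum limit and NOT the Clay problem.»  ABSOLUTE RULE (cell charter, verbatim): «No internally-minted
statement may enter as a cited fact. Every hypothesis is either kernel-proved in this package or a verbatim quotation of a PUBLISHED theorem with page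
reference. The manuscript(s) under audit are NOT citable for their own disputed steps — they are the thing under adjudication; programme-internal
(2001/route/tribunal) claims are never citable.»  Row D1 ∕ (C1) OWNER, b2b-balaban-beta-an2 gen 75, 2026-08-28.  No existing file touched.
-/

noncomputable section

open scoped BigOperators

namespace Summit.QuantumFields.BalabanUV.Beta.FP.TowerK2bDoorReadoutSummable

open Literature.MathematicalPhysics.QuantumFieldTheory.Balaban1983to89.B12Sec2to5 (l1 l1_nonneg abs_coord_le_l1)
open Literature.MathematicalPhysics.QuantumFieldTheory.Balaban1983to89.Beta.DecimatedMomentSummable (AbsMoment₂ summable_of_absMoment₂)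
open Summit.QuantumFields.BalabanUV.Beta.FP.TowerK2bDoorPairingSummable (summable_weight_mul abs_le_quad_of_le_l1 abs_mul_le_quad_of_le_l1)
open Summit.QuantumFields.BalabanUV.Beta.FP.ConvolutionAbsMoment (one_add_l1_add_sq_le)

variable {d : ℕ} {D : Type*} [Fintype D]

/-! ## §1 Summation by parts on `ℤᵈ` -/

omit [Fintype D] in
/-- [folklore] a shifted weight of quadratic growth is of quadratic growth. -/
theorem abs_shift_le_quad {f : (Fin d → ℤ) → ℝ} {B : ℝ} (hB : 0 ≤ B) (hf : ∀ y, |f y| ≤ B * (1 + l1 y ^ 2)) (e w : Fin d → ℤ) :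
    |f (w + e)| ≤ (2 * B * (1 + l1 e ^ 2)) * (1 + l1 w ^ 2) := by
  calc |f (w + e)| ≤ B * (1 + l1 (w + e) ^ 2) := hf _
    _ ≤ B * (2 * ((1 + l1 w ^ 2) * (1 + l1 e ^ 2))) := mul_le_mul_of_nonneg_left (one_add_l1_add_sq_le w e) hB
    _ = (2 * B * (1 + l1 e ^ 2)) * (1 + l1 w ^ 2) := by ring

/-- [folklore] **`tsum_mul_latticeDiv_eq` — SUMMATION BY PARTS ON THE LATTICE**: for a 1-form `A` with `AbsMoment₂ (A κ)` for every component, unit steps `e κ`, and a test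
function of quadratic growth, `∑' y, f y·Σ_κ (A κ y − A κ (y − e κ)) = Σ_κ ∑' w, (f w − f (w + e κ))·A κ w`. -/
theorem tsum_mul_latticeDiv_eq (e : D → Fin d → ℤ) (A : D → (Fin d → ℤ) → ℝ) (hA : ∀ κ, AbsMoment₂ (A κ)) (f : (Fin d → ℤ) → ℝ) {B : ℝ} (hB : 0 ≤ B)
    (hf : ∀ y, |f y| ≤ B * (1 + l1 y ^ 2)) :
    ∑' y, f y * ∑ κ, (A κ y - A κ (y - e κ)) = ∑ κ, ∑' w, (f w - f (w + e κ)) * A κ w := by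
  have h1 : ∀ κ, Summable (fun y => f y * A κ y) := fun κ => summable_weight_mul (hA κ) hf
  have h2 : ∀ κ, Summable (fun w => f (w + e κ) * A κ w) := fun κ => summable_weight_mul (hA κ) (abs_shift_le_quad hB hf (e κ))
  have h3 : ∀ κ, Summable (fun y => f y * A κ (y - e κ)) := fun κ =>
    ((Equiv.addRight (e κ)).summable_iff (f := fun y => f y * A κ (y - e κ))).mp ((h2 κ).congr fun w => by simp)
  have hs : ∀ κ, ∑' y, f y * A κ (y - e κ) = ∑' w, f (w + e κ) * A κ w := fun κ => by
    rw [← (Equiv.addRight (e κ)).tsum_eq (fun y => f y * A κ (y - e κ))]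
    exact tsum_congr fun w => by simp
  calc ∑' y, f y * ∑ κ, (A κ y - A κ (y - e κ)) = ∑' y, ∑ κ, (f y * A κ y - f y * A κ (y - e κ)) :=
        tsum_congr fun y => by rw [Finset.mul_sum]; exact Finset.sum_congr rfl fun κ _ => mul_sub _ _ _
    _ = ∑ κ, ∑' y, (f y * A κ y - f y * A κ (y - e κ)) := Summable.tsum_finsetSum fun κ _ => (h1 κ).sub (h3 κ)
    _ = ∑ κ, ∑' w, (f w - f (w + e κ)) * A κ w := Finset.sum_congr rfl fun κ _ => by
        rw [(h1 κ).tsum_sub (h3 κ), hs κ, ← (h1 κ).tsum_sub (h2 κ)]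
        exact tsum_congr fun w => by ring

/-- [folklore] **`sum_tsum_shiftDiff_mul_eq_zero_of_coclosed`**: if `A` is CO-CLOSED (`Σ_κ (A κ y − A κ (y − e κ)) = 0` for every `y`) then `Σ_κ ∑' w, (f w − f (w + e κ))·A κ w = 0`. -/
theorem sum_tsum_shiftDiff_mul_eq_zero_of_coclosed (e : D → Fin d → ℤ) (A : D → (Fin d → ℤ) → ℝ) (hA : ∀ κ, AbsMoment₂ (A κ)) (f : (Fin d → ℤ) → ℝ) {B : ℝ} (hB : 0 ≤ B)
    (hf : ∀ y, |f y| ≤ B * (1 + l1 y ^ 2)) (hdiv : ∀ y, ∑ κ, (A κ y - A κ (y - e κ)) = 0) :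
    ∑ κ, ∑' w, (f w - f (w + e κ)) * A κ w = 0 := by
  rw [← tsum_mul_latticeDiv_eq e A hA f hB hf]
  simp only [hdiv, mul_zero, tsum_zero]

/-! ## §2 Column sums and dipoles of a co-closed form -/

/-- [folklore] **`sum_weight_tsum_eq_zero_of_coclosed`** (`f = c` additive): `Σ_κ c(e κ)·(∑' w, A κ w) = 0`. -/
theorem sum_weight_tsum_eq_zero_of_coclosed (e : D → Fin d → ℤ) (A : D → (Fin d → ℤ) → ℝ) (hA : ∀ κ, AbsMoment₂ (A κ))
    (hdiv : ∀ y, ∑ κ, (A κ y - A κ (y - e κ)) = 0) (c : (Fin d → ℤ) →+ ℝ) {K : ℝ} (hK : 0 ≤ K) (hc : ∀ z, |c z| ≤ K * l1 z) :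
    ∑ κ, c (e κ) * ∑' w, A κ w = 0 := by
  have h := sum_tsum_shiftDiff_mul_eq_zero_of_coclosed e A hA c hK (abs_le_quad_of_le_l1 hK hc) hdiv
  have h' : ∑ κ, ∑' w, ((c : (Fin d → ℤ) → ℝ) w - c (w + e κ)) * A κ w = -∑ κ, c (e κ) * ∑' w, A κ w := by
    rw [← Finset.sum_neg_distrib]
    refine Finset.sum_congr rfl fun κ _ => ?_
    rw [← tsum_mul_left, ← tsum_neg]
    exact tsum_congr fun w => by rw [map_add]; ring
  rw [h'] at h
  exact neg_eq_zero.mp h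

/-- [folklore] **`tsum_col_eq_zero_of_coclosed`** — PART 43's letter `hS0` FROM CO-CLOSEDNESS: at a lattice coordinate (`c (e κ) = [κ = μ]`), `∑' w, A μ w = 0`. -/
theorem tsum_col_eq_zero_of_coclosed [DecidableEq D] (e : D → Fin d → ℤ) (A : D → (Fin d → ℤ) → ℝ) (hA : ∀ κ, AbsMoment₂ (A κ))
    (hdiv : ∀ y, ∑ κ, (A κ y - A κ (y - e κ)) = 0) (c : (Fin d → ℤ) →+ ℝ) {K : ℝ} (hK : 0 ≤ K) (hc : ∀ z, |c z| ≤ K * l1 z) (μ : D)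
    (hce : ∀ κ, c (e κ) = if κ = μ then 1 else 0) : ∑' w, A μ w = 0 := by
  have h := sum_weight_tsum_eq_zero_of_coclosed e A hA hdiv c hK hc
  simp only [hce, ite_mul, one_mul, zero_mul, Finset.sum_ite_eq', Finset.mem_univ, if_true] at h
  exact h

/-- [folklore] **`sum_weight_tsumFirstMoments_eq_zero_of_coclosed`** (`f = c·c′`):
`Σ_κ (c′(e κ)·∑' c·A κ + c(e κ)·∑' c′·A κ + c(e κ)·c′(e κ)·∑' A κ) = 0`. -/
theorem sum_weight_tsumFirstMoments_eq_zero_of_coclosed (e : D → Fin d → ℤ) (A : D → (Fin d → ℤ) → ℝ) (hA : ∀ κ, AbsMoment₂ (A κ))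
    (hdiv : ∀ y, ∑ κ, (A κ y - A κ (y - e κ)) = 0) (c c' : (Fin d → ℤ) →+ ℝ) {K K' : ℝ} (hK : 0 ≤ K) (hK' : 0 ≤ K')
    (hc : ∀ z, |c z| ≤ K * l1 z) (hc' : ∀ z, |c' z| ≤ K' * l1 z) :
    ∑ κ, (c' (e κ) * ∑' w, c w * A κ w + c (e κ) * ∑' w, c' w * A κ w + c (e κ) * c' (e κ) * ∑' w, A κ w) = 0 := by
  have h := sum_tsum_shiftDiff_mul_eq_zero_of_coclosed e A hA (fun w => c w * c' w) (mul_nonneg hK hK') (abs_mul_le_quad_of_le_l1 hK hK' hc hc') hdiv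
  have hcA : ∀ κ, Summable (fun w => c w * A κ w) := fun κ => summable_weight_mul (hA κ) (abs_le_quad_of_le_l1 hK hc)
  have hc'A : ∀ κ, Summable (fun w => c' w * A κ w) := fun κ => summable_weight_mul (hA κ) (abs_le_quad_of_le_l1 hK' hc')
  have hA0 : ∀ κ, Summable (A κ) := fun κ => summable_of_absMoment₂ (hA κ)
  have h' : ∑ κ, ∑' w, (c w * c' w - c (w + e κ) * c' (w + e κ)) * A κ w
      = -∑ κ, (c' (e κ) * ∑' w, c w * A κ w + c (e κ) * ∑' w, c' w * A κ w + c (e κ) * c' (e κ) * ∑' w, A κ w) := by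
    rw [← Finset.sum_neg_distrib]
    refine Finset.sum_congr rfl fun κ _ => ?_
    rw [← tsum_mul_left, ← tsum_mul_left, ← tsum_mul_left, ← ((hcA κ).mul_left _).tsum_add ((hc'A κ).mul_left _),
      ← (((hcA κ).mul_left _).add ((hc'A κ).mul_left _)).tsum_add ((hA0 κ).mul_left _), ← tsum_neg]
    exact tsum_congr fun w => by rw [map_add, map_add]; ring
  rw [h'] at h
  exact neg_eq_zero.mp h

/-- [folklore] **`tsum_longitudinalDipole_eq_zero_of_coclosed`**: at a lattice coordinate of direction `μ`, `∑' w, c w·A μ w = 0`. -/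
theorem tsum_longitudinalDipole_eq_zero_of_coclosed [DecidableEq D] (e : D → Fin d → ℤ) (A : D → (Fin d → ℤ) → ℝ) (hA : ∀ κ, AbsMoment₂ (A κ))
    (hdiv : ∀ y, ∑ κ, (A κ y - A κ (y - e κ)) = 0) (c : (Fin d → ℤ) →+ ℝ) {K : ℝ} (hK : 0 ≤ K) (hc : ∀ z, |c z| ≤ K * l1 z) (μ : D)
    (hce : ∀ κ, c (e κ) = if κ = μ then 1 else 0) : ∑' w, c w * A μ w = 0 := by
  have h := sum_weight_tsumFirstMoments_eq_zero_of_coclosed e A hA hdiv c c hK hK hc hc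
  have h0 := tsum_col_eq_zero_of_coclosed e A hA hdiv c hK hc μ hce
  simp only [hce, ite_mul, one_mul, zero_mul, mul_ite, mul_one, mul_zero] at h
  simp only [Finset.sum_add_distrib, Finset.sum_ite_eq', Finset.mem_univ, if_true, h0, add_zero] at h
  linarith

/-- [folklore] **`tsum_transverseDipoles_antisymm_of_coclosed`**: at coordinates of two DIFFERENT directions, `∑' w, cμ w·A ν w = −∑' w, cν w·A μ w`. -/
theorem tsum_transverseDipoles_antisymm_of_coclosed [DecidableEq D] (e : D → Fin d → ℤ) (A : D → (Fin d → ℤ) → ℝ) (hA : ∀ κ, AbsMoment₂ (A κ))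
    (hdiv : ∀ y, ∑ κ, (A κ y - A κ (y - e κ)) = 0) (cμ cν : (Fin d → ℤ) →+ ℝ) {K : ℝ} (hK : 0 ≤ K) (hcμ : ∀ z, |cμ z| ≤ K * l1 z) (hcν : ∀ z, |cν z| ≤ K * l1 z)
    (μ ν : D) (hμν : μ ≠ ν) (heμ : ∀ κ, cμ (e κ) = if κ = μ then 1 else 0) (heν : ∀ κ, cν (e κ) = if κ = ν then 1 else 0) :
    ∑' w, cμ w * A ν w = -∑' w, cν w * A μ w := by
  have h := sum_weight_tsumFirstMoments_eq_zero_of_coclosed e A hA hdiv cμ cν hK hK hcμ hcν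
  simp only [heμ, heν, ite_mul, one_mul, zero_mul, mul_ite, mul_one, mul_zero] at h
  simp only [Finset.sum_add_distrib, Finset.sum_ite_eq', Finset.mem_univ, if_true] at h
  rw [if_neg (fun h' => hμν h'.symm), add_zero] at h
  linarith

/-! ## §3 Reflections -/

omit [Fintype D] in
/-- [folklore] **`tsum_firstMoment_eq_zero_of_reflect`**: a bijection `R` of the lattice leaving the component `A κ` invariant and flipping the weight affinely (`c (R w) = k − c w`)
forces `2·∑' c·A κ = k·∑' A κ`; with a vanishing column sum the dipole vanishes (`Equiv.tsum_eq`; the weighted family summable by `AbsMoment₂`). -/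
theorem tsum_firstMoment_eq_zero_of_reflect (A : D → (Fin d → ℤ) → ℝ) (hA : ∀ κ, AbsMoment₂ (A κ)) (R : (Fin d → ℤ) ≃ (Fin d → ℤ)) (κ : D)
    (hRA : ∀ w, A κ (R w) = A κ w) (c : (Fin d → ℤ) →+ ℝ) {K : ℝ} (hK : 0 ≤ K) (hc : ∀ z, |c z| ≤ K * l1 z) (k : ℝ) (hRc : ∀ w, c (R w) = k - c w)
    (h0 : ∑' w, A κ w = 0) : ∑' w, c w * A κ w = 0 := by
  have hcA : Summable (fun w => c w * A κ w) := summable_weight_mul (hA κ) (abs_le_quad_of_le_l1 hK hc)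
  have hA0 : Summable (A κ) := summable_of_absMoment₂ (hA κ)
  have h : ∑' w, c w * A κ w = ∑' w, (k - c w) * A κ w := by
    rw [← R.tsum_eq (fun w => c w * A κ w)]
    exact tsum_congr fun w => by rw [hRc, hRA]
  have h2 : ∑' w, (k - c w) * A κ w = k * ∑' w, A κ w - ∑' w, c w * A κ w := by
    rw [← tsum_mul_left, ← (hA0.mul_left k).tsum_sub hcA]
    exact tsum_congr fun w => by ring
  rw [h2, h0, mul_zero, zero_sub] at h
  linarith

/-- [folklore] **`tsum_dipoles_eq_zero_of_coclosed_of_reflect` — THE PACKAGE ON `ℤᵈ`**: a co-closed 1-form with absolutely summable second moments (source direction `ν`), lattice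
coordinates `c ρ` (`c ρ (e κ) = [κ = ρ]`, `|c ρ z| ≤ K|z|₁`) and, for every `ρ ≠ ν`, a bijection `R ρ` flipping `c ρ` affinely and fixing every component `κ ≠ ρ`, has NO DIPOLE:
`∑' w, c ρ w·A κ w = 0` for every `(ρ, κ)` — PART 43's letter `hS1`. -/
theorem tsum_dipoles_eq_zero_of_coclosed_of_reflect [DecidableEq D] (e : D → Fin d → ℤ) (A : D → (Fin d → ℤ) → ℝ) (hA : ∀ κ, AbsMoment₂ (A κ))
    (hdiv : ∀ y, ∑ κ, (A κ y - A κ (y - e κ)) = 0) (c : D → (Fin d → ℤ) →+ ℝ) {K : ℝ} (hK : 0 ≤ K) (hc : ∀ ρ z, |c ρ z| ≤ K * l1 z)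
    (hce : ∀ ρ κ, c ρ (e κ) = if κ = ρ then 1 else 0) (ν : D) (R : D → (Fin d → ℤ) ≃ (Fin d → ℤ))
    (hRA : ∀ ρ, ρ ≠ ν → ∀ κ, κ ≠ ρ → ∀ w, A κ (R ρ w) = A κ w) (k : D → ℝ) (hRc : ∀ ρ, ρ ≠ ν → ∀ w, c ρ (R ρ w) = k ρ - c ρ w) (ρ κ : D) :
    ∑' w, c ρ w * A κ w = 0 := by
  by_cases hρκ : κ = ρ
  · subst hρκ
    exact tsum_longitudinalDipole_eq_zero_of_coclosed e A hA hdiv (c κ) hK (hc κ) κ (hce κ)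
  · by_cases hρν : ρ = ν
    · have hκν : κ ≠ ν := fun h => hρκ (h.trans hρν.symm)
      rw [tsum_transverseDipoles_antisymm_of_coclosed e A hA hdiv (c ρ) (c κ) hK (hc ρ) (hc κ) ρ κ (Ne.symm hρκ) (hce ρ) (hce κ), neg_eq_zero]
      exact tsum_firstMoment_eq_zero_of_reflect A hA (R κ) ρ (hRA κ hκν ρ (Ne.symm hρκ)) (c κ) hK (hc κ) (k κ) (hRc κ hκν)
        (tsum_col_eq_zero_of_coclosed e A hA hdiv (c ρ) hK (hc ρ) ρ (hce ρ))
    · exact tsum_firstMoment_eq_zero_of_reflect A hA (R ρ) κ (hRA ρ hρν κ hρκ) (c ρ) hK (hc ρ) (k ρ) (hRc ρ hρν)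
        (tsum_col_eq_zero_of_coclosed e A hA hdiv (c κ) hK (hc κ) κ (hce κ))

end Summit.QuantumFields.BalabanUV.Beta.FP.TowerK2bDoorReadoutSummable

end
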